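/-
Copyright (c) 2026 the pub-hodgecm-mathlib formalisation cell (harness21).  Prover seat hodgecm-mathlib-LH7-p04 (g12), 2026-09-03.
Road M6 → F5 (LEAD F0P3a-plan (g16) T14-66 ∕ T15-32; SIG-F5 v2 b42386c8 §6.2 (3); SIG-F5-END v1 §3), brick (B3) «THE F5 HEAD»: the ★ G-side head of the type-(2) clause
with `|2| = 1` DELETED — Eisenstein data instead of the odd discriminant exponent.
-/
import Literature.NumberTheory.Rogawski1990.DepthZeroKappaTransferTypeTwoGSide                   -- ★ p846592 the tame head (socket, frames, `forall_valuation_coeff_charpoly_sub_lt_one_of_isLocalNormPair`)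
import Literature.NumberTheory.Automorphic.UnitaryTypeTwoNormPairCentralizerCompactRamified      -- ★ `compactSpace_centralizer_of_isLocalNormPair_of_not_exists_isRoot_nonsplit` (no `|2|`)
import Literature.NumberTheory.Rogawski1990.EndoscopicBlockFrameAlgHom                           -- ★ (O-5) p852929: `exists_algHom_blockFrame`
import Literature.NumberTheory.Rogawski1990.DepthZeroKappaTransferTypeTwoRowTwoEisenstein        -- ★ p853295 (1) the `hrow2` DICTIONARY (LH10-p01 (g11)): `ncard_rankStrata_two_sub_eq_neg_one_pow_mul_of_eisensteinData`
import Literature.NumberTheory.Rogawski1990.DepthZeroKappaTransferTypeTwoClassTotalsAtFrame      -- ★ p853378 (B2b-II) core (LH10-p01 (g11)): `sum_ncard_rankStrata_eq_phiTHn_of_frame_of_finKappaAt_eq_one ∕ …phiTHprimen…_eq_neg_one`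
import Literature.NumberTheory.Rogawski1990.DepthZeroKappaTransferTypeTwoRowZeroAtFrame         -- ★ p853410 (B2c-II) core (LH10-p01 (g11)): `ncard_rankStrata_zero_eq_phiTHn_of_frame_of_finKappaAt_eq_one ∕ …phiTHprimen…_eq_neg_one`
import Literature.NumberTheory.Rogawski1990.TypeTwoPairPackageInertPlace                      -- ★ p853393 (B2d) CM WRAPPER (LH4-p01 (g10)): `exists_pairPackage_inertPlace` (the pass-through block X)
import Literature.NumberTheory.Rogawski1990.TypeTwoCayleyShiftCM                                -- ★ `map_finGammaTwo_mul_finGammaTwo`, `transpose_map_fst_evalRingHom_mul` (torus letters at `w`)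
import Literature.NumberTheory.Rogawski1990.UnitaryTwoTypeTwoEdgeCount                           -- ★ `placeForm_antidiagTwo_eq_antidiag`
import Literature.NumberTheory.Automorphic.UnitaryGroupIwasawaFiniteAdelic                       -- ★ `isUnit_placeForm_antidiagonal_unit_mem_glInt`, `placeForm_antidiagonal`
import HarnessLib

/-!
# T3′ (P-2), TYPE TWO, 2-FREE — the G-side at a depth-zero piece from EISENSTEIN DATA (the F5 head)

Topic `NumberTheory/Rogawski1990`; namespace `Literature.NumberTheory.Rogawski1990`.  Cell `pub/hodgecm-mathlib` (D-0151), crux H413 = `stmt-HodgeConjecture-24833`; road M6 → F5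
(LEAD F0P3a-plan (g16) T14-66 «ROW 2 ★ DYADIC TWIN» ∕ T15-32), brick **(B3) = SIG-F5 v2 §6.2 (3) = SIG-F5-END v1 §3: THE F5 HEAD**.  THEOREMS ONLY (no definition, no instance, no
notation, no named fact, no `sorry`); kernel lane `--supports stmt-HodgeConjecture-24833`.

THE STATEMENT (`finsum_finExplicitDelta_mul_classOrbitalIntegral_depthZero_eq_of_eisensteinData`) is the ★ tame G-side head
`DepthZeroKappaTransferTypeTwoGSide.finsum_finExplicitDelta_mul_classOrbitalIntegral_depthZero_eq_of_irreducible` (p846592, :211–:282) with: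
* `h2 : IsUnit (2 : 𝒪_w)` DELETED (SIG-F5 v2 Table A row 10);
* `hN : |tr² − 4 det|_w = q^{−(2N+1)}` REPLACED by the EISENSTEIN BLOCK of ★ F2 `exists_eisensteinData` ∕ ★ (W1) `ncard_vertex_rowZero_eq_of_total`'s `hT` letters (row 17):
  `Θ = α•1 + β•g_w`, `|det Θ| = |ϖ|`, `|tr Θ| < 1`, `u_w•1 − g_w = a•1 + b•Θ`, `|b| = |ϖ|^N` (`|ϖ| = q⁻¹`; `N = ord_w b` is the conductor exponent, so the conclusion's `W₂(N)`,
  `W₂(N−1)` are read token for token);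
* `hnN`, `hpar` (row 19) KEPT (★ `flicker_theorem18n` at `(n, N)` and `(n − 2, N − 1)`); `hint` (row 13, integral `χ(ι_v γ_H)_w`) STRUCK — idle: the 2-free rows read
  integrality off the depth letters `hdeep` ∕ `hg1 hu1`;
* `hrow2` KEPT as a binder (row 21) — discharged at every call site by ★ LH10-p01 `ncard_rankStrata_two_sub_eq_neg_one_pow_mul_of_eisensteinData … he …` (the `hrow2` DICTIONARY,
  `|2|_v = q^{−e}` a parameter that therefore never enters this head);
* conclusion :277–:282 TOKEN FOR TOKEN.
THE PROOF is the ★ proof :283–:382 with exactly three `have`s re-sourced (SIG-F5 v2 Table B rows 6–8): the compact centralisers of `δ₊, δ₋` from ★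
`compactSpace_centralizer_of_isLocalNormPair_of_not_exists_isRoot_nonsplit` («any non-split `v`, no `|2|`», `UnitaryTypeTwoNormPairCentralizerCompactRamified` :74); the TOTAL
row `hK` from ★ (B2b) «2-FREE CLASS TOTALS» and the ROW 0 `hK₀` from ★ (B2c) «2-FREE ROW 0» (LH10-p01; over ★ F3-5 γ p853258 ∘ ★ F5-(0) (LH4-p01) ∘ ★ (B2a) p853288 ∘ ★ F5-(3a)
p853274∕p853277 ∘ ★ (W1) p852759); `hK₂ := hrow2 …`, the socket ★ p846003 and the class-transport of the two values unchanged.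
HONEST LABEL: count-neutral 2-free twin of one ★ row of the tame chain (SIG-F5 v2 §0.4: F5 retires the `|2| = 1` of EXACTLY ONE row — type (2), depth zero, hyperspecial
vertex, G-side); its consumer, a dyadic (P-2) clause, is a separate file; `stub_N6nsDyadic` stays PRINT [LS₂] until the desk's rider; HC_CM is proved only modulo the 2 remaining
named inputs (hLiu418 24832, h413 24833) until rung 0 closes.

## References
* [Rogawski1990] J. D. Rogawski, *Automorphic Representations of Unitary Groups in Three Variables*, Ann. of Math. Stud. 123 (1990): §4.9 Prop. 4.9.1 (a)(b) pp. 54–55,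
  Lemma 4.9.3 p. 56; §4.3 (4.3.1)–(4.3.2) p. 43.
* [Flicker1998UnitaryFL] Y. Z. Flicker, *Elementary proof of the fundamental lemma for a unitary group*, Canad. J. Math. 50 (1998): Props. 16–17 pp. 96–97, §6 Thm. 18 p. 97.
* [Kottwitz1986BaseChangeUnits] R. E. Kottwitz, *Base change for unit elements of Hecke algebras*, Compositio Math. 60 (1986): §3.
* [LanglandsShelstad1987] R. P. Langlands, D. Shelstad, *On the definition of transfer factors*, Math. Ann. 278 (1987): §1.3–1.4.
-/

set_option autoImplicit false

noncomputable section

open MeasureTheory Measure Set Function NumberField IsDedekindDomain Matrix Polynomial Topology Filter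
open Literature.NumberTheory.Automorphic Literature.NumberTheory.Automorphic.UnitaryGroup
open Literature.NumberTheory.Automorphic.IntegralReduction Literature.NumberTheory.GaloisRepresentations
open Literature.NumberTheory.NumberFields Literature.NumberTheory.QuadraticForms
open scoped Matrix MatrixGroups ValuativeRel

namespace Literature.NumberTheory.Rogawski1990

variable (L : Type) [Field L] [NumberField L] [IsCMField L] (H' : Matrix (Fin 3) (Fin 3) L)
  {v : HeightOneSpectrum (𝓞 ↥(maximalRealSubfield L))}


set_option maxHeartbeats 1600000 in  -- the ≈ 60-binder ★ socket ∕ rows ∕ value instantiations (cf. ★ p846003 400000 for the socket alone)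
open scoped Classical in
/-- **THE G-SIDE OF THE TYPE-(2) CLAUSE AT A DEPTH-ZERO PIECE, 2-FREE** (see the module docstring): for a deep `G`-regular type-(2) `γ_H` with EISENSTEIN DATA of exponents `(n, N)` (no `|2| = 1`), a depth-zero piece `g`
and the canonical family of a Haar measure `ν_G`, `Σᶠ_c Δ‴_v(γ_H, c)·Φ(c, g) = ν_G(K)·((q⁻²c₀ + ((q²−1)∕q²)c₁)·W₂(N−1) + (−q⁻¹c₁ + ((q+1)∕q)c₂)·(W₂(N) − W₂(N−1)))`.
[cite: Rogawski1990, §4.9 Prop. 4.9.1 (a)(b) p. 55; §4.3 (4.3.1)–(4.3.2) p. 43] [cite: Flicker1998UnitaryFL, §6 Thm. 18 p. 97] [cite: Kottwitz1986BaseChangeUnits, §1 pp. 240–241] -/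
theorem finsum_finExplicitDelta_mul_classOrbitalIntegral_depthZero_eq_of_eisensteinData
    (hH' : (H'.map (IsCMField.complexConj L))ᵀ = H') (w : PlacesOver L v)
    (hw : IsCMField.complexConj L • w.1 = w.1) (hv : Algebra.IsUnramifiedIn (𝓞 L) v.asIdeal)
    (hH'w : IsUnit (placeForm H' w.1)) (hH'i : hH'w.unit ∈ glInt 3 (w.1.adicCompletion L))
    (μ : HeckeCharacter L) (hμ : μ.IsUnramifiedAt w.1)
    [MeasurableSpace ((cmDatum L 3 H').Local v)] [BorelSpace ((cmDatum L 3 H').Local v)]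
    [∀ γ : ((cmDatum L 3 H').Local v), MeasurableSpace (((cmDatum L 3 H').Local v) ⧸ Subgroup.centralizer ({γ} : Set ((cmDatum L 3 H').Local v)))]
    [∀ γ : ((cmDatum L 3 H').Local v), BorelSpace (((cmDatum L 3 H').Local v) ⧸ Subgroup.centralizer ({γ} : Set ((cmDatum L 3 H').Local v)))]
    (hl : ∀ (v : HeightOneSpectrum (𝓞 ↥(maximalRealSubfield L)))
      (a : ((cmDatum L 2 (Matrix.of fun i j : Fin 2 => if i.val + j.val + 1 = 2 then (1 : L) else 0)).Local v ×
      (cmDatum L 1 (Matrix.of fun i j : Fin 1 => if i.val + j.val + 1 = 1 then (1 : L) else 0)).Local v))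
      (b : (cmDatum L 3 H').Local v)
      (x : ((cmDatum L 2 (Matrix.of fun i j : Fin 2 => if i.val + j.val + 1 = 2 then (1 : L) else 0)).Local v ×
      (cmDatum L 1 (Matrix.of fun i j : Fin 1 => if i.val + j.val + 1 = 1 then (1 : L) else 0)).Local v)),
      finExplicitDelta L v H' (x * a * x⁻¹) μ b = finExplicitDelta L v H' a μ b)
    (hr : ∀ (v : HeightOneSpectrum (𝓞 ↥(maximalRealSubfield L)))
      (a : ((cmDatum L 2 (Matrix.of fun i j : Fin 2 => if i.val + j.val + 1 = 2 then (1 : L) else 0)).Local v ×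
      (cmDatum L 1 (Matrix.of fun i j : Fin 1 => if i.val + j.val + 1 = 1 then (1 : L) else 0)).Local v))
      (b y : (cmDatum L 3 H').Local v),
      finExplicitDelta L v H' a μ (y * b * y⁻¹) = finExplicitDelta L v H' a μ b)
    (hH'u : IsUnit H')
    (hμω : ∀ x : ideleGroup ↥(maximalRealSubfield L), μ (AdeleRing.ideleBaseChange ↥(maximalRealSubfield L) L x) = quadraticHeckeCharCM L x)
    {γH : ((cmDatum L 2 (Matrix.of fun i j : Fin 2 => if i.val + j.val + 1 = 2 then (1 : L) else 0)).Local v ×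
      (cmDatum L 1 (Matrix.of fun i j : Fin 1 => if i.val + j.val + 1 = 1 then (1 : L) else 0)).Local v)}
    (hreg : IsLocalGRegular L v γH)
    (hirr : ¬ ∃ x : w.1.adicCompletion L, (((γH.1.val : GL (Fin 2) (LocalRing L v)).val.map
        (Pi.evalRingHom (fun w' : PlacesOver L v => w'.1.adicCompletion L) w)).charpoly).IsRoot x)
    (hdeep : ∀ i < 3, Valued.v (((((endoEmbLocal L v γH).val : GL (Fin 3) (LocalRing L v)) : Matrix (Fin 3) (Fin 3) (LocalRing L v)).map
        (Pi.evalRingHom (fun w' : PlacesOver L v => w'.1.adicCompletion L) w)).charpoly.coeff i - (1 : Matrix (Fin 3) (Fin 3) (w.1.adicCompletion L)).charpoly.coeff i) < 1)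
    (n N : ℕ)
    (hn : Valued.v (((finCharpolyTwo L v γH).eval (finGammaTwo L v γH)) w) = WithZero.exp (-(n : ℤ)))
    -- the EISENSTEIN BLOCK of ★ F2 `exists_eisensteinData` ∕ ★ (W1)'s `hT` letters (replaces the tame `hN : |tr² − 4det| = q^{−(2N+1)}`; `N = ord_w b`)
    {ϖ : w.1.adicCompletion L} (hϖ : Valued.v ϖ = WithZero.exp (-1 : ℤ))
    {Θ : Matrix (Fin 2) (Fin 2) (w.1.adicCompletion L)} {α β a b : w.1.adicCompletion L}
    (hΘ : Θ = α • (1 : Matrix (Fin 2) (Fin 2) (w.1.adicCompletion L)) +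
      β • ((γH.1.val : GL (Fin 2) (LocalRing L v)).val.map (Pi.evalRingHom (fun w' : PlacesOver L v => w'.1.adicCompletion L) w)))
    (hΘd : Valued.v Θ.det = Valued.v ϖ) (hΘt : Valued.v Θ.trace < 1)
    (hrel : finGammaTwo L v γH w • (1 : Matrix (Fin 2) (Fin 2) (w.1.adicCompletion L)) -
        (γH.1.val : GL (Fin 2) (LocalRing L v)).val.map (Pi.evalRingHom (fun w' : PlacesOver L v => w'.1.adicCompletion L) w) =
      a • (1 : Matrix (Fin 2) (Fin 2) (w.1.adicCompletion L)) + b • Θ)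
    (hb : Valued.v b = Valued.v ϖ ^ N)
    (hn2 : 2 ≤ n) (hN1 : 1 ≤ N) (hnN : n ≤ 2 * N + 1) (hpar : Even n ∨ n = 2 * N + 1)
    (hg1 : ∀ i j, Valued.v ((((γH.1.val : GL (Fin 2) (LocalRing L v)).val.map (Pi.evalRingHom (fun w' : PlacesOver L v => w'.1.adicCompletion L) w)) - 1) i j) ≤ WithZero.exp (-1 : ℤ))
    (hu1 : Valued.v (finGammaTwo L v γH w - 1) ≤ WithZero.exp (-1 : ℤ))
    -- R2², the FREE ROW of the socket, as a hypothesis (★ `ncard_rankStrata_two_sub_eq_neg_one_pow_mul` by name at the call site)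
    (hrow2 : ∀ δp : (cmDatum L 3 H').Local v, IsLocalNormPair L H' v γH δp → finKappaAt L v H' γH δp = 1 →
      (∀ m : ℕ, ValuativeRel.valuation (w.1.adicCompletion L)
        (((((δp.val : GL (Fin 3) (LocalRing L v)).val.map (Pi.evalRingHom (fun w' : UnitaryGroup.PlacesOver L v => w'.1.adicCompletion L) w))).charpoly -
          (Polynomial.X - 1) ^ 3).coeff m) < 1) →
      ∀ δm : (cmDatum L 3 H').Local v, IsLocalNormPair L H' v γH δm → finKappaAt L v H' γH δm = -1 →
      (∀ m : ℕ, ValuativeRel.valuation (w.1.adicCompletion L)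
        (((((δm.val : GL (Fin 3) (LocalRing L v)).val.map (Pi.evalRingHom (fun w' : UnitaryGroup.PlacesOver L v => w'.1.adicCompletion L) w))).charpoly -
          (Polynomial.X - 1) ^ 3).coeff m) < 1) →
      (({q : (cmDatum L 3 H').Local v ⧸ cmLocalIntegralLevel L 3 H' v |
          q ∈ MulAction.fixedBy ((cmDatum L 3 H').Local v ⧸ cmLocalIntegralLevel L 3 H' v) δp ∧
            (redMat ((((q.out⁻¹ * δp * q.out : (cmDatum L 3 H').Local v)).val : GL (Fin 3) (LocalRing L v)).val.map
              (Pi.evalRingHom (fun w' : UnitaryGroup.PlacesOver L v => w'.1.adicCompletion L) w)) - 1).rank = 2}.ncard : ℕ) : ℚ) -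
        (({q : (cmDatum L 3 H').Local v ⧸ cmLocalIntegralLevel L 3 H' v |
          q ∈ MulAction.fixedBy ((cmDatum L 3 H').Local v ⧸ cmLocalIntegralLevel L 3 H' v) δm ∧
            (redMat ((((q.out⁻¹ * δm * q.out : (cmDatum L 3 H').Local v)).val : GL (Fin 3) (LocalRing L v)).val.map
              (Pi.evalRingHom (fun w' : UnitaryGroup.PlacesOver L v => w'.1.adicCompletion L) w)) - 1).rank = 2}.ncard : ℕ) : ℚ) =
        (-1 : ℚ) ^ n * ((Ideal.absNorm v.asIdeal : ℚ) + 1) * (Ideal.absNorm v.asIdeal : ℚ) ^ (N + n - 1))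
    (νG : Measure ((cmDatum L 3 H').Local v)) [νG.IsHaarMeasure] [νG.IsMulRightInvariant]
    {mG : OrbitalMeasureFamily ((cmDatum L 3 H').Local v)}
    (hmG : mG.IsCanonical (fun γ => IsRegularElt (γ.val : GL (Fin 3) (UnitaryGroup.LocalRing L v))) νG)
    (g : ((cmDatum L 3 H').Local v) → ℂ) (hg : IsLocSmooth g) (hgK : tsupport g ⊆ (cmLocalIntegralLevel L 3 H' v : Set ((cmDatum L 3 H').Local v)))
    (hginv : ∀ u ∈ cmLocalIntegralLevel L 3 H' v, ∀ x, g (u * x * u⁻¹) = g x)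
    (c : ℕ → ℂ)
    (hc : ∀ k ∈ cmLocalIntegralLevel L 3 H' v,
      (redMat (((k.val : GL (Fin 3) (UnitaryGroup.LocalRing L v)).val.map (Pi.evalRingHom (fun w' : PlacesOver L v => w'.1.adicCompletion L) w))) - 1) ^ 3 = 0 →
      g k = c (redMat (((k.val : GL (Fin 3) (UnitaryGroup.LocalRing L v)).val.map (Pi.evalRingHom (fun w' : PlacesOver L v => w'.1.adicCompletion L) w))) - 1).rank) :
    ∑ᶠ cG : ConjClasses ((cmDatum L 3 H').Local v),
        (finExplicitCollection L H' μ hl hr v).Δ γH (Quotient.out cG) * classOrbitalIntegral mG g cG =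
      (νG.real (cmLocalIntegralLevel L 3 H' v : Set ((cmDatum L 3 H').Local v)) : ℂ) *
        (((((Ideal.absNorm v.asIdeal : ℂ)) ^ 2)⁻¹ * c 0 + ((((Ideal.absNorm v.asIdeal : ℂ)) ^ 2 - 1) / ((Ideal.absNorm v.asIdeal : ℂ)) ^ 2) * c 1) *
          ((Flicker1998.phiHtwo (Ideal.absNorm v.asIdeal) (N - 1) : ℚ) : ℂ) +
        (-((Ideal.absNorm v.asIdeal : ℂ))⁻¹ * c 1 + ((((Ideal.absNorm v.asIdeal : ℂ)) + 1) / ((Ideal.absNorm v.asIdeal : ℂ))) * c 2) *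
          ((Flicker1998.phiHtwo (Ideal.absNorm v.asIdeal) N - Flicker1998.phiHtwo (Ideal.absNorm v.asIdeal) (N - 1) : ℚ) : ℂ)) := by
  have hq : 1 < Ideal.absNorm v.asIdeal :=
    Nat.one_lt_iff_ne_zero_and_ne_one.2 ⟨by rw [Ne, Ideal.absNorm_eq_zero_iff]; exact v.ne_bot,
      by rw [Ne, Ideal.absNorm_eq_one_iff]; exact v.isPrime.ne_top⟩
  have hH'c : (H'.map (cmConjRingHom L))ᵀ = H' := by
    have e1 : H'.map (cmConjRingHom L) = H'.map (IsCMField.complexConj L) := by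
      ext i j; simp [Matrix.map_apply, cmConjRingHom_apply]
    rw [e1]; exact hH'
  have hdet : H'.det ≠ 0 := (Matrix.isUnit_iff_isUnit_det _ |>.1 hH'u).ne_zero
  -- keep the (large) goal out of the eliminators' motives while gathering the frame; it comes back at `exact hneg …`
  by_contra hneg
  -- (1) a match `b` with its block frame, `χ_g` irreducible, `χ_g(u)` a unit, the local hermitian data (as ★ the (P3)-irreducible stub frame)
  obtain ⟨b, h⟩ := exists_isLocalNormPair_of_nonsplit L H' hH' w hw hv hH'w hH'i γH
  have hA : Irreducible ((γH.1.val : GL (Fin 2) (UnitaryGroup.LocalRing L v)).val.charpoly) :=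
    irreducible_charpoly_of_not_exists_isRoot_eval L v w hw _ hirr
  obtain ⟨δ₁, hcδ, hδ⟩ : ∃ δ : L, IsCMField.complexConj L δ = -δ ∧ δ ≠ 0 := by
    obtain ⟨ζ, hζ⟩ := not_forall.1 fun h0 => IsCMField.complexConj_ne_one L (AlgEquiv.ext h0)
    refine ⟨ζ - IsCMField.complexConj L ζ, by rw [map_sub, IsCMField.complexConj_apply_apply, neg_sub], fun h0 => hζ ?_⟩
    rw [sub_eq_zero] at h0
    exact h0.symm
  have hF := Liu2021.LemD1IndexedNonVacuityNonsplitPlace.isField_localRing_of_nonsplit L v (IsCMField.complexConj L) hcδ hδ w hw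
  have hu : IsUnit ((finCharpolyTwo L v γH).eval (finGammaTwo L v γH)) := by
    have hne : (finCharpolyTwo L v γH).eval (finGammaTwo L v γH) ≠ 0 := by
      letI : Field (UnitaryGroup.LocalRing L v) := hF.toField
      exact Literature.LinearAlgebra.Matrix.eval_charpoly_ne_zero_of_irreducible hA (by simp) _
    obtain ⟨y, hy⟩ := hF.mul_inv_cancel hne
    exact IsUnit.of_mul_eq_one _ hy
  have hH := map_conjLocal_transpose_localForm L 3 H' v hH'c
  have hHd := isUnit_det_localForm L 3 H' v hdet
  obtain ⟨cj, hcj⟩ := isConj_iff.1 h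
  have hP := mul_eq_mul_reindex_fromBlocks_of_conj_endoEmbLocal_eq L H' γH hcj
  -- (2) the other class and the signed pair `(δ₊, δ₋)`
  obtain ⟨δ₀, hst₀, -, hκ₀⟩ := exists_isStablyConj_finKappaAt_eq_neg L v H' γH b w hw h hu hH hHd endoPerm hP hA
  have hδ₀ : IsLocalNormPair L H' v γH δ₀ := isLocalNormPair_of_mk_mem_conjClassesIn L v H' γH b h (mk_mem_conjClassesIn_iff.2 hst₀)
  obtain ⟨δp, δm, hp, hκp, hm, hκm⟩ : ∃ δp δm : (cmDatum L 3 H').Local v,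
      IsLocalNormPair L H' v γH δp ∧ finKappaAt L v H' γH δp = 1 ∧ IsLocalNormPair L H' v γH δm ∧ finKappaAt L v H' γH δm = -1 := by
    rcases finKappaAt_eq_one_or_eq_neg_one_of_isUnit L v H' γH b h hu with hκ | hκ
    · exact ⟨b, δ₀, h, hκ, hδ₀, by rw [hκ₀, hκ]⟩
    · exact ⟨δ₀, b, hδ₀, by rw [hκ₀, hκ]; norm_num, h, hκ⟩
  -- every match is deep, regular, with compact centraliser
  have hdeepδ := fun (δ : (cmDatum L 3 H').Local v) (hδ : IsLocalNormPair L H' v γH δ) =>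
    forall_valuation_coeff_charpoly_sub_lt_one_of_isLocalNormPair L H' w hdeep hδ
  have hregp : IsRegularElt (δp.val : GL (Fin 3) (LocalRing L v)) := isRegularElt_of_isLocalNormPair L H' v hp hreg
  haveI : CompactSpace (Subgroup.centralizer ({δp} : Set ((cmDatum L 3 H').Local v))) :=
    compactSpace_centralizer_of_isLocalNormPair_of_not_exists_isRoot_nonsplit L v w hw hH'u hreg hirr δp hp
  have hregm : IsRegularElt (δm.val : GL (Fin 3) (LocalRing L v)) := isRegularElt_of_isLocalNormPair L H' v hm hreg
  haveI : CompactSpace (Subgroup.centralizer ({δm} : Set ((cmDatum L 3 H').Local v))) :=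
    compactSpace_centralizer_of_isLocalNormPair_of_not_exists_isRoot_nonsplit L v w hw hH'u hreg hirr δm hm
  -- the frames of `δ₊`, `δ₋` (for ★ `finKappaAt_eq_iff_isConj`)
  obtain ⟨cp, hcp⟩ := isConj_iff.1 hp
  have hPp := mul_eq_mul_reindex_fromBlocks_of_conj_endoEmbLocal_eq L H' γH hcp
  obtain ⟨cm, hcm⟩ := isConj_iff.1 hm
  have hPm := mul_eq_mul_reindex_fromBlocks_of_conj_endoEmbLocal_eq L H' γH hcm
  -- (3) the values of the piece at `δ₊`, `δ₋` (★ O8b)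
  have hvalp := classOrbitalIntegral_eq_mul_strata_three_of_deep L v w hw νG hH'c hdet hmG δp hregp (hdeepδ δp hp) g hg hgK hginv c hc
  have hvalm := classOrbitalIntegral_eq_mul_strata_three_of_deep L v w hw νG hH'c hdet hmG δm hregm (hdeepδ δm hm) g hg hgK hginv c hc
  -- the strata-count functions of the socket
  let nS : ((cmDatum L 3 H').Local v) → ℕ → ℕ := fun t r => {q : (cmDatum L 3 H').Local v ⧸ cmLocalIntegralLevel L 3 H' v |
          q ∈ MulAction.fixedBy ((cmDatum L 3 H').Local v ⧸ cmLocalIntegralLevel L 3 H' v) t ∧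
            (redMat ((((q.out⁻¹ * t * q.out : (cmDatum L 3 H').Local v)).val : GL (Fin 3) (LocalRing L v)).val.map
              (Pi.evalRingHom (fun w' : UnitaryGroup.PlacesOver L v => w'.1.adicCompletion L) w)) - 1).rank = r}.ncard
  -- (4) the three rows
  -- the frame `T ∈ GL₃(𝒪_w)` carrying `H′_w` to `J₀` (★ F0P3-p02), and `q = #𝓀(L⁺_v)` in the spine's `ValuativeRel` currency
  have hc1 : IsCMField.complexConj L ≠ 1 := IsCMField.complexConj_ne_one L
  obtain ⟨T, hTint, hJT⟩ := exists_glInt_placeForm_eq_formCongr_antidiagonal_of_isUnramifiedIn ↥(maximalRealSubfield L) L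
    (IsCMField.complexConj L) hc1 3 H' hH' v w hw hv hH'w hH'i
  have hqv : Nat.card (IsLocalRing.ResidueField ↥(ValuativeRel.valuation (v.adicCompletion ↥(maximalRealSubfield L))).integer) = Ideal.absNorm v.asIdeal := by
    rw [natCard_residueField_eq_of_compatible, IsDedekindDomain.HeightOneSpectrum.natCard_residueField_adicCompletion, Ideal.absNorm_apply,
      Submodule.cardQuot_apply]
  -- ### the form `J₀ = antidiag(1,1,1)` at `w` as a unit (★ (B2b-II)'s spelling) and the one-place letters of the pair `(g_w, u_w)`
  have hΦw : IsUnit (placeForm ((StdForm.antidiagonal 3).over L) w.1) := by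
    rw [placeForm_antidiagonal]; exact (StdForm.antidiagonal 3).isUnit_over _
  have hJ0 : hΦw.unit ∈ glInt 3 (w.1.adicCompletion L) := isUnit_placeForm_antidiagonal_unit_mem_glInt (E := L) (N := 3) w.1 hΦw
  have hJ0m : ((hΦw.unit : GL (Fin 3) (w.1.adicCompletion L)) : Matrix (Fin 3) (Fin 3) (w.1.adicCompletion L)) = (StdForm.antidiagonal 3).over (w.1.adicCompletion L) := by
    rw [IsUnit.unit_spec, placeForm_antidiagonal]
  have hJ0h : (((hΦw.unit : GL (Fin 3) (w.1.adicCompletion L)) : Matrix (Fin 3) (Fin 3) (w.1.adicCompletion L)).map (galAdicCompletionMap (L := L) (IsCMField.complexConj L) hw))ᵀ = hΦw.unit := by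
    rw [hJ0m, StdForm.over_map, StdForm.transpose_over]
  -- integrality of `g_w`, `u_w` (from the depth letters), the torus letters `u·σu = 1`, `g ∈ U(antidiag(1,1))`
  have hexp1 : WithZero.exp (-1 : ℤ) ≤ (1 : WithZero (Multiplicative ℤ)) :=
    le_of_lt (by rw [← WithZero.exp_zero]; exact WithZero.exp_lt_exp.2 (by norm_num))
  have hvle : ∀ x : (w.1.adicCompletion L), Valued.v (x - 1) ≤ WithZero.exp (-1 : ℤ) → Valued.v x ≤ 1 := fun x hx => by
    have h := Valuation.map_add Valued.v (x - 1) 1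
    rw [sub_add_cancel, map_one] at h
    exact h.trans (max_le (hx.trans hexp1) le_rfl)
  have hgO : ∀ i j, (((γH.1.val : GL (Fin 2) (LocalRing L v)).val).map (Pi.evalRingHom (fun w' : PlacesOver L v => w'.1.adicCompletion L) w)) i j ∈ 𝒪[(w.1.adicCompletion L)] := by
    intro i j
    refine (v_le_one_iff_mem_integer _).1 ?_
    by_cases hij : i = j
    · subst hij
      refine hvle _ ?_
      have h := hg1 i i
      rwa [Matrix.sub_apply, Matrix.one_apply_eq] at h
    · have h := hg1 i j
      rw [Matrix.sub_apply, Matrix.one_apply_ne hij, sub_zero] at h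
      exact h.trans hexp1
  have huO : (finGammaTwo L v γH w) ∈ 𝒪[(w.1.adicCompletion L)] := (v_le_one_iff_mem_integer _).1 (hvle _ hu1)
  have hσu : (finGammaTwo L v γH w) * (galAdicCompletionMap (L := L) (IsCMField.complexConj L) hw) (finGammaTwo L v γH w) = 1 := by
    rw [mul_comm]; exact map_finGammaTwo_mul_finGammaTwo L v w hw γH
  have hgunit : (((((γH.1.val : GL (Fin 2) (LocalRing L v)).val).map (Pi.evalRingHom (fun w' : PlacesOver L v => w'.1.adicCompletion L) w))).map (galAdicCompletionMap (L := L) (IsCMField.complexConj L) hw))ᵀ * (!![0, 1; 1, 0] : Matrix (Fin 2) (Fin 2) (w.1.adicCompletion L)) * (((γH.1.val : GL (Fin 2) (LocalRing L v)).val).map (Pi.evalRingHom (fun w' : PlacesOver L v => w'.1.adicCompletion L) w)) = !![0, 1; 1, 0] := by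
    have h := transpose_map_fst_evalRingHom_mul L v w hw γH
    rw [UnitaryGroup.placeForm_antidiagTwo_eq_antidiag L v w] at h
    exact h
  -- ### the class of `δp`: block frame `T·c_w`, its algebra map, the identification `φ_b(g_w,u_w) = T δ_w T⁻¹`, unitarity for `J₀`, the package X, the two counts
  obtain ⟨φ₀p, hφ₀p, hφ₀pw⟩ := exists_algHom_blockFrame_apply_eq_of_conj_place L H' w γH hcp
  set cwp : GL (Fin 3) (w.1.adicCompletion L) := Units.map (RingHom.mapMatrix (Pi.evalRingHom (fun w' : PlacesOver L v => w'.1.adicCompletion L) w)).toMonoidHom cp with hcwpdef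
  have hcfrp : ((T * cwp : GL (Fin 3) (w.1.adicCompletion L)) : Matrix (Fin 3) (Fin 3) (w.1.adicCompletion L)) =
      (T : Matrix (Fin 3) (Fin 3) (w.1.adicCompletion L)) * ((cp : GL (Fin 3) (LocalRing L v)) : Matrix (Fin 3) (Fin 3) (LocalRing L v)).map (Pi.evalRingHom (fun w' : PlacesOver L v => w'.1.adicCompletion L) w) := by
    rw [Units.val_mul]; rfl
  obtain ⟨φbp, hφbp⟩ := exists_algHom_blockFrame (T * cwp)
  have hframep : φbp ((((γH.1.val : GL (Fin 2) (LocalRing L v)).val).map (Pi.evalRingHom (fun w' : PlacesOver L v => w'.1.adicCompletion L) w)), (finGammaTwo L v γH w)) =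
      (T : Matrix (Fin 3) (Fin 3) (w.1.adicCompletion L)) * ((δp.val : GL (Fin 3) (LocalRing L v)) : Matrix (Fin 3) (Fin 3) (LocalRing L v)).map (Pi.evalRingHom (fun w' : PlacesOver L v => w'.1.adicCompletion L) w) *
        ((T⁻¹ : GL (Fin 3) (w.1.adicCompletion L)) : Matrix (Fin 3) (Fin 3) (w.1.adicCompletion L)) := by
    have e1 := hφ₀p (((γH.1.val : GL (Fin 2) (LocalRing L v)).val).map (Pi.evalRingHom (fun w' : PlacesOver L v => w'.1.adicCompletion L) w)) (finGammaTwo L v γH w)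
    rw [hφ₀pw] at e1
    rw [hφbp, _root_.mul_inv_rev, Units.val_mul, Units.val_mul, e1]
    simp only [Matrix.mul_assoc]
  have hδJp : ((((δp.val : GL (Fin 3) (LocalRing L v)) : Matrix (Fin 3) (Fin 3) (LocalRing L v)).map (Pi.evalRingHom (fun w' : PlacesOver L v => w'.1.adicCompletion L) w)).map (galAdicCompletionMap (L := L) (IsCMField.complexConj L) hw))ᵀ * placeForm H' w.1 *
      ((δp.val : GL (Fin 3) (LocalRing L v)) : Matrix (Fin 3) (Fin 3) (LocalRing L v)).map (Pi.evalRingHom (fun w' : PlacesOver L v => w'.1.adicCompletion L) w) = placeForm H' w.1 :=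
    (UnitaryGroup.localNonsplitEquiv (IsCMField.complexConj L) H' hc1 w hw δp).2
  have hmemp : (Units.map (RingHom.mapMatrix (Pi.evalRingHom (fun w' : PlacesOver L v => w'.1.adicCompletion L) w)).toMonoidHom (δp.val : GL (Fin 3) (LocalRing L v)) : GL (Fin 3) (w.1.adicCompletion L)) ∈
      unitaryGroupOfForm (galAdicCompletionMap (L := L) (IsCMField.complexConj L) hw) (formCongr (galAdicCompletionMap (L := L) (IsCMField.complexConj L) hw) T ((StdForm.antidiagonal 3).over (w.1.adicCompletion L))) := by
    rw [mem_unitaryGroupOfForm_iff, ← hJT]; exact hδJp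
  have hτJp : ((φbp ((((γH.1.val : GL (Fin 2) (LocalRing L v)).val).map (Pi.evalRingHom (fun w' : PlacesOver L v => w'.1.adicCompletion L) w)), (finGammaTwo L v γH w))).map (galAdicCompletionMap (L := L) (IsCMField.complexConj L) hw))ᵀ * ((hΦw.unit : GL (Fin 3) (w.1.adicCompletion L)) : Matrix (Fin 3) (Fin 3) (w.1.adicCompletion L)) * φbp ((((γH.1.val : GL (Fin 2) (LocalRing L v)).val).map (Pi.evalRingHom (fun w' : PlacesOver L v => w'.1.adicCompletion L) w)), (finGammaTwo L v γH w)) = hΦw.unit := by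
    have h2 := mem_unitaryGroupOfForm_iff.1 (conj_mem_unitaryGroupOfForm (galAdicCompletionMap (L := L) (IsCMField.complexConj L) hw) T ((StdForm.antidiagonal 3).over (w.1.adicCompletion L)) hmemp)
    rw [Units.val_mul, Units.val_mul] at h2
    rw [hframep, hJ0m]
    exact h2
  obtain ⟨Mp, _i1p, _i2p, _i3p, w₁p, aFp, k₀p, θp, s'p, φp, lamp, Pp, ⟨haFp, hk₀p, hθp, hθvp, hcoordp, hintθp, hs'ιp, hs'θp, hs's'p, hs'Op, hs'vp, hnorm1p⟩,
      ⟨hφinjp, hstarp⟩, ⟨hlamp, hφxp, hKup, hallp, hcoordlamp⟩, ⟨hPp_, hPxp⟩, hgateVp⟩ :=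
    exists_pairPackage_inertPlace L w hw hv hΦw.unit hJ0 hJ0h (T * cwp) φbp hφbp hgO huO hσu hτJp hgunit hϖ hΘ hΘd hΘt hrel hb
  simp only [hJ0m] at hstarp hgateVp
  -- ### the class of `δm`: block frame `T·c_w`, its algebra map, the identification `φ_b(g_w,u_w) = T δ_w T⁻¹`, unitarity for `J₀`, the package X, the two counts
  obtain ⟨φ₀m, hφ₀m, hφ₀mw⟩ := exists_algHom_blockFrame_apply_eq_of_conj_place L H' w γH hcm
  set cwm : GL (Fin 3) (w.1.adicCompletion L) := Units.map (RingHom.mapMatrix (Pi.evalRingHom (fun w' : PlacesOver L v => w'.1.adicCompletion L) w)).toMonoidHom cm with hcwmdef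
  have hcfrm : ((T * cwm : GL (Fin 3) (w.1.adicCompletion L)) : Matrix (Fin 3) (Fin 3) (w.1.adicCompletion L)) =
      (T : Matrix (Fin 3) (Fin 3) (w.1.adicCompletion L)) * ((cm : GL (Fin 3) (LocalRing L v)) : Matrix (Fin 3) (Fin 3) (LocalRing L v)).map (Pi.evalRingHom (fun w' : PlacesOver L v => w'.1.adicCompletion L) w) := by
    rw [Units.val_mul]; rfl
  obtain ⟨φbm, hφbm⟩ := exists_algHom_blockFrame (T * cwm)
  have hframem : φbm ((((γH.1.val : GL (Fin 2) (LocalRing L v)).val).map (Pi.evalRingHom (fun w' : PlacesOver L v => w'.1.adicCompletion L) w)), (finGammaTwo L v γH w)) =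
      (T : Matrix (Fin 3) (Fin 3) (w.1.adicCompletion L)) * ((δm.val : GL (Fin 3) (LocalRing L v)) : Matrix (Fin 3) (Fin 3) (LocalRing L v)).map (Pi.evalRingHom (fun w' : PlacesOver L v => w'.1.adicCompletion L) w) *
        ((T⁻¹ : GL (Fin 3) (w.1.adicCompletion L)) : Matrix (Fin 3) (Fin 3) (w.1.adicCompletion L)) := by
    have e1 := hφ₀m (((γH.1.val : GL (Fin 2) (LocalRing L v)).val).map (Pi.evalRingHom (fun w' : PlacesOver L v => w'.1.adicCompletion L) w)) (finGammaTwo L v γH w)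
    rw [hφ₀mw] at e1
    rw [hφbm, _root_.mul_inv_rev, Units.val_mul, Units.val_mul, e1]
    simp only [Matrix.mul_assoc]
  have hδJm : ((((δm.val : GL (Fin 3) (LocalRing L v)) : Matrix (Fin 3) (Fin 3) (LocalRing L v)).map (Pi.evalRingHom (fun w' : PlacesOver L v => w'.1.adicCompletion L) w)).map (galAdicCompletionMap (L := L) (IsCMField.complexConj L) hw))ᵀ * placeForm H' w.1 *
      ((δm.val : GL (Fin 3) (LocalRing L v)) : Matrix (Fin 3) (Fin 3) (LocalRing L v)).map (Pi.evalRingHom (fun w' : PlacesOver L v => w'.1.adicCompletion L) w) = placeForm H' w.1 :=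
    (UnitaryGroup.localNonsplitEquiv (IsCMField.complexConj L) H' hc1 w hw δm).2
  have hmemm : (Units.map (RingHom.mapMatrix (Pi.evalRingHom (fun w' : PlacesOver L v => w'.1.adicCompletion L) w)).toMonoidHom (δm.val : GL (Fin 3) (LocalRing L v)) : GL (Fin 3) (w.1.adicCompletion L)) ∈
      unitaryGroupOfForm (galAdicCompletionMap (L := L) (IsCMField.complexConj L) hw) (formCongr (galAdicCompletionMap (L := L) (IsCMField.complexConj L) hw) T ((StdForm.antidiagonal 3).over (w.1.adicCompletion L))) := by
    rw [mem_unitaryGroupOfForm_iff, ← hJT]; exact hδJm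
  have hτJm : ((φbm ((((γH.1.val : GL (Fin 2) (LocalRing L v)).val).map (Pi.evalRingHom (fun w' : PlacesOver L v => w'.1.adicCompletion L) w)), (finGammaTwo L v γH w))).map (galAdicCompletionMap (L := L) (IsCMField.complexConj L) hw))ᵀ * ((hΦw.unit : GL (Fin 3) (w.1.adicCompletion L)) : Matrix (Fin 3) (Fin 3) (w.1.adicCompletion L)) * φbm ((((γH.1.val : GL (Fin 2) (LocalRing L v)).val).map (Pi.evalRingHom (fun w' : PlacesOver L v => w'.1.adicCompletion L) w)), (finGammaTwo L v γH w)) = hΦw.unit := by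
    have h2 := mem_unitaryGroupOfForm_iff.1 (conj_mem_unitaryGroupOfForm (galAdicCompletionMap (L := L) (IsCMField.complexConj L) hw) T ((StdForm.antidiagonal 3).over (w.1.adicCompletion L)) hmemm)
    rw [Units.val_mul, Units.val_mul] at h2
    rw [hframem, hJ0m]
    exact h2
  obtain ⟨Mm, _i1m, _i2m, _i3m, w₁m, aFm, k₀m, θm, s'm, φm, lamm, Pm, ⟨haFm, hk₀m, hθm, hθvm, hcoordm, hintθm, hs'ιm, hs'θm, hs's'm, hs'Om, hs'vm, hnorm1m⟩,
      ⟨hφinjm, hstarm⟩, ⟨hlamm, hφxm, hKum, hallm, hcoordlamm⟩, ⟨hPm_, hPxm⟩, hgateVm⟩ :=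
    exists_pairPackage_inertPlace L w hw hv hΦw.unit hJ0 hJ0h (T * cwm) φbm hφbm hgO huO hσu hτJm hgunit hϖ hΘ hΘd hΘt hrel hb
  simp only [hJ0m] at hstarm hgateVm
  -- the CLASS TOTALS, 2-free: ★ (B2b-II) «CLASS TOTALS AT A FRAME» (LH10-p01) over ★ (B2b-I) p853318 ∘ ★ (B2a) p853288 ∘ ★ F5-(0) p853304 ∘ ★ γ p853258
  have hTp : ((nS δp 0 + nS δp 1 + nS δp 2 : ℕ) : ℚ) = Flicker1998.phiTHn (Ideal.absNorm v.asIdeal) n N := by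
    have h := sum_ncard_rankStrata_eq_phiTHn_of_frame_of_finKappaAt_eq_one hH' w hw hv hH'u hreg hirr δp hp (hdeepδ δp hp) hcp T hTint hJT w₁p haFp hk₀p s'p hθp hθvp hcoordp hintθp hs'ιp hs'θp hs's'p hs'Op hs'vp hnorm1p (T * cwp) hcfrp φbp hφbp φp hφinjp hstarp hϖ hΘ hΘd hΘt hrel n N hn hb hg1 hu1 hlamp hφxp hKup hallp hcoordlamp Pp hPp_ hPxp hgateVp hκp
    rw [hqv] at h
    exact h
  have hTm : ((nS δm 0 + nS δm 1 + nS δm 2 : ℕ) : ℚ) = Flicker1998.phiTHprimen (Ideal.absNorm v.asIdeal) n N := by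
    have h := sum_ncard_rankStrata_eq_phiTHprimen_of_frame_of_finKappaAt_eq_neg_one hH' w hw hv hH'u hreg hirr δm hm (hdeepδ δm hm) hcm T hTint hJT w₁m haFm hk₀m s'm hθm hθvm hcoordm hintθm hs'ιm hs'θm hs's'm hs'Om hs'vm hnorm1m (T * cwm) hcfrm φbm hφbm φm hφinjm hstarm hϖ hΘ hΘd hΘt hrel n N hn hb hg1 hu1 hlamm hφxm hKum hallm hcoordlamm Pm hPm_ hPxm hgateVm hκm
    rw [hqv] at h
    exact h
  -- TOTAL row of the socket: Flicker's Theorem 18 on the class totals (as ★ `…UnitRow` :268)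
  have hK : ((nS δp 0 + nS δp 1 + nS δp 2 : ℕ) : ℚ) - ((nS δm 0 + nS δm 1 + nS δm 2 : ℕ) : ℚ) =
      (-(Ideal.absNorm v.asIdeal : ℚ)) ^ n * Flicker1998.phiHtwo (Ideal.absNorm v.asIdeal) N := by
    rw [hTp, hTm]
    exact Flicker1998.flicker_theorem18n hq hnN hpar
  -- the ROW-0 counts, 2-free: ★ (B2c) «2-FREE ROW 0 AT THE PLACE» (LH10-p01) over ★ ED.2 p853277 `cast_ncard_vertex_rowZero_eq_of_total` ∘ ★ `shift_pairLetters` p853274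
  have h0p : ((nS δp 0 : ℕ) : ℚ) = Flicker1998.phiTHn (Ideal.absNorm v.asIdeal) (n - 2) (N - 1) := by
    have h := ncard_rankStrata_zero_eq_phiTHn_of_frame_of_finKappaAt_eq_one hH' w hw hv hH'u hirr δp hp (hdeepδ δp hp) hcp T hTint hJT w₁p haFp hk₀p s'p hθp hθvp hcoordp hintθp hs'ιp hs'θp hs's'p hs'Op hs'vp hnorm1p (T * cwp) hcfrp φbp hφbp φp hφinjp hstarp hϖ hΘ hΘd hΘt hrel n N hn hb hg1 hu1 hlamp hφxp hallp hcoordlamp Pp hPp_ hPxp hgateVp hn2 hN1 hκp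
    rw [hqv] at h
    exact h
  have h0m : ((nS δm 0 : ℕ) : ℚ) = Flicker1998.phiTHprimen (Ideal.absNorm v.asIdeal) (n - 2) (N - 1) := by
    have h := ncard_rankStrata_zero_eq_phiTHprimen_of_frame_of_finKappaAt_eq_neg_one hH' w hw hv hH'u hirr δm hm (hdeepδ δm hm) hcm T hTint hJT w₁m haFm hk₀m s'm hθm hθvm hcoordm hintθm hs'ιm hs'θm hs's'm hs'Om hs'vm hnorm1m (T * cwm) hcfrm φbm hφbm φm hφinjm hstarm hϖ hΘ hΘd hΘt hrel n N hn hb hg1 hu1 hlamm hφxm hallm hcoordlamm Pm hPm_ hPxm hgateVm hn2 hN1 hκm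
    rw [hqv] at h
    exact h
  -- ROW 0 of the socket: Theorem 18 at the shifted exponents `(n − 2, N − 1)`
  have hK₀ : ((nS δp 0 : ℕ) : ℚ) - ((nS δm 0 : ℕ) : ℚ) =
      (-(Ideal.absNorm v.asIdeal : ℚ)) ^ (n - 2) * Flicker1998.phiHtwo (Ideal.absNorm v.asIdeal) (N - 1) := by
    rw [h0p, h0m]
    refine Flicker1998.flicker_theorem18n hq (by omega) ?_
    rcases hpar with ⟨k, hk⟩ | h
    · exact Or.inl ⟨k - 1, by omega⟩
    · exact Or.inr (by omega)
  have hK₂ := hrow2 δp hp hκp (hdeepδ δp hp) δm hm hκm (hdeepδ δm hm)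
  have hnlog : WithZero.log (Valued.v (((finCharpolyTwo L v γH).eval (finGammaTwo L v γH)) w)) = -(n : ℤ) := by rw [hn, WithZero.log_exp]
  -- (5) the socket
  have hsock := finsum_finExplicitDelta_mul_classOrbitalIntegral_eq_of_irreducible_of_strata L v H' γH b w hw μ hμω hv hμ hl hr h hu hH hHd endoPerm hP hA mG g
    n N hnlog hn2 hN1 hq (νG.real (cmLocalIntegralLevel L 3 H' v : Set ((cmDatum L 3 H').Local v)) : ℂ) c (nS δp) (nS δm)
    hK hK₀ hK₂
    (fun δ hδ hκ => by
      -- same sign ⇒ same class as `δ₊` ⇒ same value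
      have hst : IsStablyConj (UnitaryGroup.conjLocal L (IsCMField.complexConj L) v) ((UnitaryGroup.adelicForm L 3 H').map (UnitaryGroup.adeleToLocal L v))
          ⟨δp.val, δp.2⟩ ⟨δ.val, δ.2⟩ := by
        have h1 := hp; have h2' := hδ
        rw [isLocalNormPair_iff] at h1 h2'
        exact h1.isStablyConj_right h2'
      obtain ⟨gδ, hgδ⟩ := isStablyConj_iff.1 hst
      have hconj := (finKappaAt_eq_iff_isConj L v H' γH δp δ w hw hp hu hH hHd endoPerm hPp hA hgδ).1 (hκ.trans hκp.symm)
      have hmk : ConjClasses.mk δ = ConjClasses.mk δp := (ConjClasses.mk_eq_mk_iff_isConj.2 hconj).symm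
      rw [hmk, hvalp])
    (fun δ hδ hκ => by
      have hst : IsStablyConj (UnitaryGroup.conjLocal L (IsCMField.complexConj L) v) ((UnitaryGroup.adelicForm L 3 H').map (UnitaryGroup.adeleToLocal L v))
          ⟨δm.val, δm.2⟩ ⟨δ.val, δ.2⟩ := by
        have h1 := hm; have h2' := hδ
        rw [isLocalNormPair_iff] at h1 h2'
        exact h1.isStablyConj_right h2'
      obtain ⟨gδ, hgδ⟩ := isStablyConj_iff.1 hst
      have hconj := (finKappaAt_eq_iff_isConj L v H' γH δm δ w hw hm hu hH hHd endoPerm hPm hA hgδ).1 (hκ.trans hκm.symm)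
      have hmk : ConjClasses.mk δ = ConjClasses.mk δm := (ConjClasses.mk_eq_mk_iff_isConj.2 hconj).symm
      rw [hmk, hvalm])
  exact hneg hsock


set_option maxHeartbeats 1600000 in  -- as above
open scoped Classical in
/-- **THE SAME WITH THE FREE ROW DISCHARGED** by ★ LH10-p01's `hrow2` DICTIONARY (p853295): the only new letter is the dyadic PARAMETER `|2|_v = q^{−e}` (`e = 0` off `2`), which the
row-2 count needs and the conclusion does not see. [cite: Rogawski1990, §4.9 Prop. 4.9.1 (b) p. 55, Lemma 4.9.3 p. 56] [cite: Flicker1998UnitaryFL, Props. 16–17 pp. 96–97; Thm. 18 p. 97] -/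
theorem finsum_finExplicitDelta_mul_classOrbitalIntegral_depthZero_eq_of_eisensteinData_of_valued_two
    (hH' : (H'.map (IsCMField.complexConj L))ᵀ = H') (w : PlacesOver L v)
    (hw : IsCMField.complexConj L • w.1 = w.1) (hv : Algebra.IsUnramifiedIn (𝓞 L) v.asIdeal)
    (hH'w : IsUnit (placeForm H' w.1)) (hH'i : hH'w.unit ∈ glInt 3 (w.1.adicCompletion L))
    (μ : HeckeCharacter L) (hμ : μ.IsUnramifiedAt w.1)
    [MeasurableSpace ((cmDatum L 3 H').Local v)] [BorelSpace ((cmDatum L 3 H').Local v)]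
    [∀ γ : ((cmDatum L 3 H').Local v), MeasurableSpace (((cmDatum L 3 H').Local v) ⧸ Subgroup.centralizer ({γ} : Set ((cmDatum L 3 H').Local v)))]
    [∀ γ : ((cmDatum L 3 H').Local v), BorelSpace (((cmDatum L 3 H').Local v) ⧸ Subgroup.centralizer ({γ} : Set ((cmDatum L 3 H').Local v)))]
    (hl : ∀ (v : HeightOneSpectrum (𝓞 ↥(maximalRealSubfield L)))
      (a : ((cmDatum L 2 (Matrix.of fun i j : Fin 2 => if i.val + j.val + 1 = 2 then (1 : L) else 0)).Local v ×
      (cmDatum L 1 (Matrix.of fun i j : Fin 1 => if i.val + j.val + 1 = 1 then (1 : L) else 0)).Local v))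
      (b : (cmDatum L 3 H').Local v)
      (x : ((cmDatum L 2 (Matrix.of fun i j : Fin 2 => if i.val + j.val + 1 = 2 then (1 : L) else 0)).Local v ×
      (cmDatum L 1 (Matrix.of fun i j : Fin 1 => if i.val + j.val + 1 = 1 then (1 : L) else 0)).Local v)),
      finExplicitDelta L v H' (x * a * x⁻¹) μ b = finExplicitDelta L v H' a μ b)
    (hr : ∀ (v : HeightOneSpectrum (𝓞 ↥(maximalRealSubfield L)))
      (a : ((cmDatum L 2 (Matrix.of fun i j : Fin 2 => if i.val + j.val + 1 = 2 then (1 : L) else 0)).Local v ×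
      (cmDatum L 1 (Matrix.of fun i j : Fin 1 => if i.val + j.val + 1 = 1 then (1 : L) else 0)).Local v))
      (b y : (cmDatum L 3 H').Local v),
      finExplicitDelta L v H' a μ (y * b * y⁻¹) = finExplicitDelta L v H' a μ b)
    (hH'u : IsUnit H')
    (hμω : ∀ x : ideleGroup ↥(maximalRealSubfield L), μ (AdeleRing.ideleBaseChange ↥(maximalRealSubfield L) L x) = quadraticHeckeCharCM L x)
    {γH : ((cmDatum L 2 (Matrix.of fun i j : Fin 2 => if i.val + j.val + 1 = 2 then (1 : L) else 0)).Local v ×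
      (cmDatum L 1 (Matrix.of fun i j : Fin 1 => if i.val + j.val + 1 = 1 then (1 : L) else 0)).Local v)}
    (hreg : IsLocalGRegular L v γH)
    (hirr : ¬ ∃ x : w.1.adicCompletion L, (((γH.1.val : GL (Fin 2) (LocalRing L v)).val.map
        (Pi.evalRingHom (fun w' : PlacesOver L v => w'.1.adicCompletion L) w)).charpoly).IsRoot x)
    (hdeep : ∀ i < 3, Valued.v (((((endoEmbLocal L v γH).val : GL (Fin 3) (LocalRing L v)) : Matrix (Fin 3) (Fin 3) (LocalRing L v)).map
        (Pi.evalRingHom (fun w' : PlacesOver L v => w'.1.adicCompletion L) w)).charpoly.coeff i - (1 : Matrix (Fin 3) (Fin 3) (w.1.adicCompletion L)).charpoly.coeff i) < 1)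
    (n N : ℕ)
    (hn : Valued.v (((finCharpolyTwo L v γH).eval (finGammaTwo L v γH)) w) = WithZero.exp (-(n : ℤ)))
    {e : ℕ} (he : Valued.v (2 : v.adicCompletion ↥(maximalRealSubfield L)) = WithZero.exp (-(e : ℤ)))
    -- the EISENSTEIN BLOCK of ★ F2 `exists_eisensteinData` ∕ ★ (W1)'s `hT` letters (replaces the tame `hN : |tr² − 4det| = q^{−(2N+1)}`; `N = ord_w b`)
    {ϖ : w.1.adicCompletion L} (hϖ : Valued.v ϖ = WithZero.exp (-1 : ℤ))
    {Θ : Matrix (Fin 2) (Fin 2) (w.1.adicCompletion L)} {α β a b : w.1.adicCompletion L}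
    (hΘ : Θ = α • (1 : Matrix (Fin 2) (Fin 2) (w.1.adicCompletion L)) +
      β • ((γH.1.val : GL (Fin 2) (LocalRing L v)).val.map (Pi.evalRingHom (fun w' : PlacesOver L v => w'.1.adicCompletion L) w)))
    (hΘd : Valued.v Θ.det = Valued.v ϖ) (hΘt : Valued.v Θ.trace < 1)
    (hrel : finGammaTwo L v γH w • (1 : Matrix (Fin 2) (Fin 2) (w.1.adicCompletion L)) -
        (γH.1.val : GL (Fin 2) (LocalRing L v)).val.map (Pi.evalRingHom (fun w' : PlacesOver L v => w'.1.adicCompletion L) w) =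
      a • (1 : Matrix (Fin 2) (Fin 2) (w.1.adicCompletion L)) + b • Θ)
    (hb : Valued.v b = Valued.v ϖ ^ N)
    (hn2 : 2 ≤ n) (hN1 : 1 ≤ N) (hnN : n ≤ 2 * N + 1) (hpar : Even n ∨ n = 2 * N + 1)
    (hg1 : ∀ i j, Valued.v ((((γH.1.val : GL (Fin 2) (LocalRing L v)).val.map (Pi.evalRingHom (fun w' : PlacesOver L v => w'.1.adicCompletion L) w)) - 1) i j) ≤ WithZero.exp (-1 : ℤ))
    (hu1 : Valued.v (finGammaTwo L v γH w - 1) ≤ WithZero.exp (-1 : ℤ))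
    (νG : Measure ((cmDatum L 3 H').Local v)) [νG.IsHaarMeasure] [νG.IsMulRightInvariant]
    {mG : OrbitalMeasureFamily ((cmDatum L 3 H').Local v)}
    (hmG : mG.IsCanonical (fun γ => IsRegularElt (γ.val : GL (Fin 3) (UnitaryGroup.LocalRing L v))) νG)
    (g : ((cmDatum L 3 H').Local v) → ℂ) (hg : IsLocSmooth g) (hgK : tsupport g ⊆ (cmLocalIntegralLevel L 3 H' v : Set ((cmDatum L 3 H').Local v)))
    (hginv : ∀ u ∈ cmLocalIntegralLevel L 3 H' v, ∀ x, g (u * x * u⁻¹) = g x)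
    (c : ℕ → ℂ)
    (hc : ∀ k ∈ cmLocalIntegralLevel L 3 H' v,
      (redMat (((k.val : GL (Fin 3) (UnitaryGroup.LocalRing L v)).val.map (Pi.evalRingHom (fun w' : PlacesOver L v => w'.1.adicCompletion L) w))) - 1) ^ 3 = 0 →
      g k = c (redMat (((k.val : GL (Fin 3) (UnitaryGroup.LocalRing L v)).val.map (Pi.evalRingHom (fun w' : PlacesOver L v => w'.1.adicCompletion L) w))) - 1).rank) :
    ∑ᶠ cG : ConjClasses ((cmDatum L 3 H').Local v),
        (finExplicitCollection L H' μ hl hr v).Δ γH (Quotient.out cG) * classOrbitalIntegral mG g cG =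
      (νG.real (cmLocalIntegralLevel L 3 H' v : Set ((cmDatum L 3 H').Local v)) : ℂ) *
        (((((Ideal.absNorm v.asIdeal : ℂ)) ^ 2)⁻¹ * c 0 + ((((Ideal.absNorm v.asIdeal : ℂ)) ^ 2 - 1) / ((Ideal.absNorm v.asIdeal : ℂ)) ^ 2) * c 1) *
          ((Flicker1998.phiHtwo (Ideal.absNorm v.asIdeal) (N - 1) : ℚ) : ℂ) +
        (-((Ideal.absNorm v.asIdeal : ℂ))⁻¹ * c 1 + ((((Ideal.absNorm v.asIdeal : ℂ)) + 1) / ((Ideal.absNorm v.asIdeal : ℂ))) * c 2) *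
          ((Flicker1998.phiHtwo (Ideal.absNorm v.asIdeal) N - Flicker1998.phiHtwo (Ideal.absNorm v.asIdeal) (N - 1) : ℚ) : ℂ)) :=
  finsum_finExplicitDelta_mul_classOrbitalIntegral_depthZero_eq_of_eisensteinData L H' hH' w hw hv hH'w hH'i μ hμ hl hr hH'u hμω hreg hirr hdeep n N hn hϖ hΘ hΘd hΘt
    hrel hb hn2 hN1 hnN hpar hg1 hu1 (ncard_rankStrata_two_sub_eq_neg_one_pow_mul_of_eisensteinData L H' hH' w hw hv hH'w hH'i he hreg hirr n hn (by omega) hϖ hΘ hΘd hΘt hrel hb)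
    νG hmG g hg hgK hginv c hc

end Literature.NumberTheory.Rogawski1990

end
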